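import Literature.AlgebraicTopology.Homotopy.ExhaustionCWType
import Literature.AlgebraicTopology.Homotopy.ManifoldCompactFactorization
import Literature.AlgebraicTopology.Homotopy.CellularApproximationProofs
import Literature.AlgebraicTopology.Homotopy.CountableCWDominated
import Mathlib.Topology.Metrizable.Urysohn
import HarnessLib

/-!
# Manifolds are dominated by countable CW complexes (proof file of `ManifoldCWType.lean`)

Topic `Literature/AlgebraicTopology/Homotopy`; sibling PROOF file (D-0014) of
`ManifoldCWType.lean`, whose named fact `Manifold.countable_cwDominated` (Milnor, *On spaces
having the homotopy type of a CW-complex* (1959), Thm. 1 (d)⇒(b) with the proof of Cor. 1,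
pp. 272–273: every second countable Hausdorff manifold is dominated by a countable CW complex)
was reduced in `ExhaustionCWType.lean`
(`Manifold.countable_cwDominated_of_hasCompactCWFactorization`, together with Cor. 1 itself,
`Manifold.exists_cwComplex_homotopyEquiv_of_hasCompactCWFactorization`) to two inputs:
the cellular approximation theorem (`cellularApproximation`, Hatcher Thm. 4.8, named fact of
`CellularApproximation.lean`) and the *compact factorization property* of manifolds
(`HasCompactCWFactorization M`: every compact `K ⊆ M` factors up to homotopy through a finite
CW complex). This file PROVES the second input and, the first having been discharged in
`CellularApproximationProofs.lean` (`cellularApproximation_holds`), the fact itself: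

* `Manifold.hasCompactCWFactorization`: every Hausdorff second countable topological
  `n`-manifold `M` (`ChartedSpace (EuclideanSpace ℝ (Fin n)) M`) has
  `HasCompactCWFactorization M`.
* `Manifold.countable_cwDominated_holds : Manifold.countable_cwDominated` — **DISCHARGE** of the
  named fact (Milnor 1959, Thm. 1 (d)⇒(b) with the proof of Cor. 1): every Hausdorff second
  countable topological `n`-manifold is dominated by a countable Hausdorff CW complex (indeed
  homotopy equivalent to one, `Manifold.exists_cwComplex_homotopyEquiv_of_hasCompactCWFactorization`,
  and a homotopy equivalence is a domination, Thm. 1 (a)⇒(b)).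

It is the packaging of the tree's cube factorization `exists_cube_factorization`
(`ManifoldCompactFactorization.lean`: for compact `K` in a locally compact metric space with an
atlas on `ℝⁿ`, a finite lattice cube complex `P ⊆ ℝᴺ`, a coordinate map `F : M → ℝᴺ` with
`F(K) ⊆ P`, a cube-by-cube extension `b : P → M` and a homotopy from the inclusion of `K` to
`b ∘ F|K` — the tree's form of Milnor's Lemma 4 / Hatcher's proof of Thm. A.7 on a compact
piece), through the finite CW structure of lattice cube complexes
(`Literature.Topology.Euclidean.LatticeCube.cwComplex`, `finite_cwComplex`) and the universe
lift `HasCompactCWFactorization.of_small`. The manifold is metrised by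
`TopologicalSpace.metrizableSpaceMetric` (locally compact Hausdorff second countable spaces are
metrizable); the empty manifold factors through the empty cube complex.

The architecture of the discharge, against the printed proof: Milnor proves (d)⇒(b) by Hanner's
theorem that an ANR is dominated by the nerve of a fine locally finite cover (Thm. 1, p. 272;
Lemma 4, p. 279, for paracompact ELCX spaces) and gets Cor. 1 from "every separable manifold is
an absolute neighborhood retract" (Hanner, Thm. 3.3; p. 273). The tree replaces the ANR theory
by an exhaustion argument with the same ingredients on compact pieces: `M = ⋃ Kⱼ` with `Kⱼ`
compact, `Kⱼ ⊆ interior Kⱼ₊₁` (σ-compactness and local compactness); each `Kⱼ` factors up to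
homotopy through a finite cube complex `Pⱼ` (`Manifold.hasCompactCWFactorization`, the chart-wise
form of Lemma 4); `M` is homotopy equivalent to the mapping telescope of the inclusions
`Kⱼ ↪ Kⱼ₊₁` (`SequenceTelescope.homotopyEquivExhaustion`, as in Hatcher §3.F, proof of Thm. 3F.8,
using a height function `exists_height_of_exhaustion`), which by homotopy invariance and interleaving of
telescopes is homotopy equivalent to the telescope of the composite maps `Pⱼ → Pⱼ₊₁`, and after
cellular approximation of those maps (Hatcher Thm. 4.8, `cellularApproximation_holds`) that
telescope is a countable Hausdorff CW complex (Hatcher Prop. A.11 pattern;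
`HasCompactCWFactorization.exists_countable_cwComplex_homotopyEquiv`). A homotopy equivalence is
in particular a domination. No named facts, no `sorry`; axioms standard.

Appended (section "Hatcher's Prop. A.11 in the countable case"): the discharge
`exists_countable_cwComplex_homotopyEquiv_of_countable_cwDominated_holds` of the second named
fact of `ManifoldCWType.lean` (a space dominated by a countable CW complex has the homotopy type
of one), by the telescope argument of `CountableCWDominated.lean` and `cellularApproximation_holds`.

## References

* J. Milnor, *On spaces having the homotopy type of a CW-complex*, Trans. Amer. Math. Soc. 90
  (1959) 272–280: Thm. 1, Cor. 1 and its proof (pp. 272–273), Lemma 4 (p. 279). [Milnor1959]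
* A. Hatcher, *Algebraic Topology*, CUP (2002), Appendix, proof of Thm. A.7 (p. 527), Prop. A.11
  (p. 529); §4.1 Thm. 4.8 (p. 349). [HatcherAT2002]
-/

noncomputable section

open Set Topology unitInterval Function
open scoped ContinuousMap
open Literature.Topology.Euclidean Literature.Topology.Euclidean.LatticeCube

universe u

namespace Literature.AlgebraicTopology.Homotopy

/-- **Topological manifolds have the compact factorization property**: every compact subset
`K` of a Hausdorff second countable topological `n`-manifold `M` factors up to homotopy through
a finite CW complex — namely through a finite lattice cube complex `P ⊆ ℝᴺ`
(`exists_cube_factorization`: a coordinate map `F : M → ℝᴺ` with `F(K) ⊆ P`, a cube-by-cube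
extension `b : P → M` and a homotopy from the inclusion of `K` to `b ∘ F|K`; Milnor 1959,
proof of Cor. 1 via Lemma 4, p. 279, with cubes for simplices; Hatcher 2002, proof of Thm. A.7)
carrying its finite CW structure `LatticeCube.cwComplex`, lifted to the universe of `M` by
`HasCompactCWFactorization.of_small`. The manifold, being locally compact
(`ChartedSpace.locallyCompactSpace`), Hausdorff and second countable, is metrised by
`TopologicalSpace.metrizableSpaceMetric`; an empty manifold factors through the empty cube
complex. [cite: Milnor1959, Cor. 1 (proof, p. 273) and Lemma 4 (p. 279)] -/
theorem Manifold.hasCompactCWFactorization (n : ℕ) (M : Type u) [TopologicalSpace M]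
    [T2Space M] [SecondCountableTopology M] [ChartedSpace (EuclideanSpace ℝ (Fin n)) M] :
    HasCompactCWFactorization M := by
  haveI : LocallyCompactSpace M := ChartedSpace.locallyCompactSpace (EuclideanSpace ℝ (Fin n)) M
  refine HasCompactCWFactorization.of_small fun K hK => ?_
  rcases isEmpty_or_nonempty M with hM | hM
  · -- the empty manifold: factor through the empty cube complex
    haveI : IsEmpty ↥K := ⟨fun x => hM.false x.1⟩
    haveI : IsEmpty ↥(complex (∅ : Finset (Fin 0 → ℤ)) 1) :=
      ⟨fun y => by obtain ⟨b, hb, -⟩ := mem_complex.1 y.2; simp at hb⟩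
    haveI : IsEmpty (I × ↥K) := ⟨fun p => isEmptyElim p.2⟩
    letI : CWComplex (univ : Set ↥(complex (∅ : Finset (Fin 0 → ℤ)) 1)) := cwComplex ∅ 1 one_pos
    let a : C(↥K, ↥(complex (∅ : Finset (Fin 0 → ℤ)) 1)) :=
      ⟨isEmptyElim, continuous_of_discreteTopology⟩
    let b : C(↥(complex (∅ : Finset (Fin 0 → ℤ)) 1), M) :=
      ⟨isEmptyElim, continuous_of_discreteTopology⟩
    refine ⟨↥(complex (∅ : Finset (Fin 0 → ℤ)) 1), inferInstance, inferInstance, ‹_›,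
      finite_cwComplex one_pos, a, b, ⟨?_⟩⟩
    exact
      { toFun := fun p => isEmptyElim p.2
        continuous_toFun := continuous_of_discreteTopology
        map_zero_left := fun x => isEmptyElim x
        map_one_left := fun x => isEmptyElim x }
  · -- a nonempty manifold: the cube factorization of `ManifoldCompactFactorization.lean`
    letI : MetricSpace M := TopologicalSpace.metrizableSpaceMetric M
    obtain ⟨N, h, 𝒬, F, b, H, hh, hFc, hFK, hbc, -, hHc, hH0, hH1, -⟩ :=
      exists_cube_factorization (n := n) hK isOpen_univ (subset_univ K)
    letI : CWComplex (univ : Set ↥(complex 𝒬 h)) := cwComplex 𝒬 h hh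
    let a : C(↥K, ↥(complex 𝒬 h)) :=
      ⟨fun x => ⟨F x, hFK x x.2⟩, (hFc.comp continuous_subtype_val).subtype_mk _⟩
    let b' : C(↥(complex 𝒬 h), M) := ⟨(complex 𝒬 h).restrict b, hbc.restrict⟩
    have hGc : Continuous fun p : I × ↥K => H (p.2 : M) (p.1 : ℝ) :=
      hHc.comp_continuous
        ((continuous_subtype_val.comp continuous_snd).prodMk
          (continuous_subtype_val.comp continuous_fst))
        fun p => ⟨p.2.2, p.1.2⟩
    -- the homotopy from the inclusion of `K` to `b ∘ F|K`, reversed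
    let G : (⟨(Subtype.val : K → M), continuous_subtype_val⟩ : C(↥K, M)).Homotopy (b'.comp a) :=
      { toFun := fun p => H (p.2 : M) (p.1 : ℝ)
        continuous_toFun := hGc
        map_zero_left := fun x => hH0 x x.2
        map_one_left := fun x => hH1 x x.2 }
    exact ⟨↥(complex 𝒬 h), inferInstance, inferInstance, ‹_›, finite_cwComplex hh, a, b',
      ⟨G.symm⟩⟩

/-! ### The discharge: Milnor's Theorem 1 (d)⇒(b) for manifolds -/

/-- **DISCHARGE of `Manifold.countable_cwDominated`** (Milnor, *On spaces having the homotopy type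
of a CW-complex* (1959), Thm. 1 (d)⇒(b), applied to manifolds as in the proof of Cor. 1,
pp. 272–273): every Hausdorff second countable topological `n`-manifold is dominated by a
countable Hausdorff CW complex. PROVED, sorry-free: the exhaustion theorem
`Manifold.countable_cwDominated_of_hasCompactCWFactorization` (the manifold is even homotopy
equivalent to a countable CW complex — the mapping telescope of cellular approximations of the
maps `Pⱼ → Pⱼ₊₁` between the finite cube complexes through which the compact pieces factor — and
a homotopy equivalence `e` is a domination, `e⁻¹ ∘ e ≃ id`, Thm. 1 (a)⇒(b), "trivial", p. 272)
fed with the cellular approximation theorem (`cellularApproximation_holds`, Hatcher Thm. 4.8,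
discharged in `CellularApproximationProofs.lean`) and the compact factorization of manifolds
(`Manifold.hasCompactCWFactorization` above).
[cite: Milnor1959, Thm. 1 (d)⇒(b) with the proof of Cor. 1 (pp. 272–273)] -/
theorem Manifold.countable_cwDominated_holds : Manifold.countable_cwDominated.{u} :=
  Manifold.countable_cwDominated_of_hasCompactCWFactorization cellularApproximation_holds
    fun n M _ _ _ _ => Manifold.hasCompactCWFactorization n M

/-! ### The discharge: Hatcher's Prop. A.11 in the countable case -/

/-- **DISCHARGE of `exists_countable_cwComplex_homotopyEquiv_of_countable_cwDominated`**
(Hatcher, *Algebraic Topology* (2002), Prop. A.11 (p. 528), countable case; Milnor 1959, Thm. 1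
(b)⇒(a)): a space dominated by a countable Hausdorff CW complex has the homotopy type of a
countable Hausdorff CW complex. PROVED, sorry-free: the telescope argument of
`CountableCWDominated.lean`
(`exists_countable_cwComplex_homotopyEquiv_of_countable_cwDominated_of_cellularApproximation`:
`M ≃ T(g, g, …) ≃ T(i∘d, …) ≃ T(d∘i on C, …) ≃ T(cellular approximations)`, a countable CW
complex by `SeqTelescope.cwComplex`) fed with the cellular approximation theorem
(`cellularApproximation_holds`, Hatcher Thm. 4.8, `CellularApproximationProofs.lean`).
[cite: HatcherAT2002, Prop. A.11 (p. 528)] [cite: Milnor1959, Thm. 1 (b)⇒(a) (p. 272)] -/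
theorem exists_countable_cwComplex_homotopyEquiv_of_countable_cwDominated_holds :
    exists_countable_cwComplex_homotopyEquiv_of_countable_cwDominated.{u} :=
  exists_countable_cwComplex_homotopyEquiv_of_countable_cwDominated_of_cellularApproximation
    cellularApproximation_holds.{u, u}

end Literature.AlgebraicTopology.Homotopy

end
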